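import Mathlib.MeasureTheory.Measure.Lebesgue.Basic
import Mathlib.Analysis.Normed.Module.Ball.Pointwise
import Mathlib.Algebra.GroupWithZero.Action.Pointwise.Set
import Literature.Geometry.Lorentzian.HorizonPenetratingTeukolsky
import Literature.Geometry.Lorentzian.KerrSchildHomogeneity
import Literature.Geometry.Lorentzian.LeviCivitaProofs
import HarnessLib

/-!
# The black-box Teukolsky slab law is dilation covariant

Stub `D4` (`stub_slabLaw_dilate`) of the line `bounded-kappa-closing-box` for the crux
`BulkKerrCaptureC2` (route `PhaseMixingCapture`). The Kerr family is homothetic — in Kerr–Schild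
Cartesian coordinates `g_{λM,λa}(λx) = g_{M,a}(x)`, and the chart domains are dilation covariant
(`Kerr.mem_region_dilate_iff`) — so the black-box law `Kerr.TeukolskySlabLawOn` (the format of
Dafermos–Holzegel–Rodnianski–Taylor, arXiv:2212.14093, (1.3)) at the parameters
`(M, a, r₀, k, w, R, Λ)` transports to the dilated parameters `(λM, λa, λr₀, k, w, λR, K Λ)` with
ONE constant `K ≥ 1` for all `λ` in a compact range `[lo, hi] ⊂ (0, ∞)`, all `(M, a, r₀, R)` and
all `Λ ≥ 0`. The two analytic inputs arrive as hypotheses (the landed neighbour stubs `D2`, `D3`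
of the same line):

* `hPair` (`D2`): a sourced pair `(α, F)` on the slab `τ₀ ≤ t* ≤ τ₁` of the dilated chart pulls
  back along `D_λ : y ↦ λy` to the sourced pair `(α ∘ D_λ, F ∘ D_λ)` on the slab
  `τ₀/λ ≤ t* ≤ τ₁/λ` of the original chart;
* `hEnergy` (`D3`): the weighted energies `Kerr.teukolskyEnergyOn` of `α` (dilated chart, leaf
  `λτ`, set `λ • A`) and of `α ∘ D_λ` (original chart, leaf `τ`, set `A`) bound each other up to
  a constant uniform for `λ ∈ [lo, hi]`.

Proof (bookkeeping). Fix `λ ∈ [lo, hi]`, a law at `(M, a, r₀)` with constant `Λ` and a sourced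
pair `(α, F)` on the slab `[τ₀, τ₁]` of the dilated chart, and apply the law to the pulled-back
pair on `[τ₀/λ, τ₁/λ]`. The left-hand side at the dilated parameters (local first-order energy
through `{t* = τ₁} ∩ {‖y‖ ≤ λR}` plus its time integral over the slab) is at most `D · KL` times
the left-hand side for the pulled-back pair (`hEnergy` at `(s, 1, 0)`, `λ • B̄(0, R) = B̄(0, λR)`,
and the substitution `τ = λσ`, `dτ = λ dσ`, in the time integral); the right-hand side for the
pulled-back pair is at most `D · KR` times the right-hand side at the dilated parameters
(`hEnergy` at `(s, k, w)`, `λ • ℝ³ = ℝ³`, the same substitution read backwards, `dσ = λ⁻¹ dτ`).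
Here `D = max 1 (max hi lo⁻¹) ≥ 1, λ, λ⁻¹` and `KL`, `KR` are the maxima over `s = ±2` of the
constants of `hEnergy`; the constant `K = max 1 (D KL · D KR)` works.

## References

* M. Dafermos, G. Holzegel, I. Rodnianski, M. Taylor, arXiv:2212.14093, §1.1 (1.3)
  (key `DafermosHolzegelRodnianskiTaylor2022`).
* R. P. Kerr, A. Schild, 1965, §2 (key `KerrSchild1965`).
-/

-- the doubled `FinalStateConjecture.FinalStateConjecture` path component trips dupNamespace
set_option linter.dupNamespace false

noncomputable section

namespace Summit.FinalStateConjecture.FinalStateConjecture.Theorems.BulkKerrCaptureC2.SlabLawDilate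

open Literature.Geometry.Lorentzian MeasureTheory Set
open scoped Manifold ContDiff Topology Pointwise ENNReal

variable {lam : ℝ}

/-! ### The change of variables `τ = λσ` on the time axis and two pointwise set identities -/

/-- **Change of variables `τ = λσ` in a `lintegral` over a time interval** (`λ > 0`, ANY `G`,
no measurability needed): `∫⁻_{σ ∈ (a/λ, b/λ)} G(λσ) dσ = λ⁻¹ ∫⁻_{τ ∈ (a, b)} G(τ) dτ`
(Lebesgue measure on `ℝ` scales by `λ` under the measurable equivalence `σ ↦ λσ`,
`Real.map_volume_mul_left`). [folklore] -/
private theorem lintegral_Ioo_div_comp_mul (hlam : 0 < lam) (a b : ℝ) (G : ℝ → ℝ≥0∞) :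
    ∫⁻ σ in Ioo (a / lam) (b / lam), G (lam * σ) =
      ENNReal.ofReal lam⁻¹ * ∫⁻ τ in Ioo a b, G τ := by
  have hne : lam ≠ 0 := hlam.ne'
  set e : ℝ ≃ᵐ ℝ := (Homeomorph.mulLeft₀ lam hne).toMeasurableEquiv
  have he : (e : ℝ → ℝ) = fun σ ↦ lam * σ := rfl
  have hpre : e ⁻¹' Ioo a b = Ioo (a / lam) (b / lam) := by
    rw [he]
    exact preimage_const_mul_Ioo₀ a b hlam
  calc ∫⁻ σ in Ioo (a / lam) (b / lam), G (lam * σ) = ∫⁻ σ in e ⁻¹' Ioo a b, G (e σ) := by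
        rw [hpre, he]
    _ = ∫⁻ τ, G τ ∂((volume.restrict (e ⁻¹' Ioo a b)).map e) := (lintegral_map_equiv G e).symm
    _ = ENNReal.ofReal lam⁻¹ * ∫⁻ τ in Ioo a b, G τ := by
        rw [← MeasurableEquiv.restrict_map, he, Real.map_volume_mul_left hne,
          Measure.restrict_smul, lintegral_smul_measure, smul_eq_mul,
          abs_of_pos (inv_pos.2 hlam)]

/-- The same change of variables read forwards:
`∫⁻_{τ ∈ (a, b)} G(τ) dτ = λ ∫⁻_{σ ∈ (a/λ, b/λ)} G(λσ) dσ` (`λ > 0`, ANY `G`). [folklore] -/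
private theorem lintegral_Ioo_eq_mul_dilate (hlam : 0 < lam) (a b : ℝ) (G : ℝ → ℝ≥0∞) :
    ∫⁻ τ in Ioo a b, G τ =
      ENNReal.ofReal lam * ∫⁻ σ in Ioo (a / lam) (b / lam), G (lam * σ) := by
  rw [lintegral_Ioo_div_comp_mul hlam, ← mul_assoc, ← ENNReal.ofReal_mul hlam.le,
    mul_inv_cancel₀ hlam.ne', ENNReal.ofReal_one, one_mul]

/-- `λ • B̄(0, R) = B̄(0, λR)` in `ℝ³` for `λ > 0` (no sign condition on `R`). [folklore] -/
private theorem smul_closedBall_zero (hlam : 0 < lam) (R : ℝ) :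
    lam • Metric.closedBall (0 : E3) R = Metric.closedBall 0 (lam * R) := by
  rw [smul_closedBall' hlam.ne', smul_zero, Real.norm_of_nonneg hlam.le]

/-! ### The arithmetic of the transport -/

/-- **The constants chain** in `ℝ≥0∞`: if the dilated left-hand terms `x₁, x₂` are bounded by
`KL y₁`, `λ KL y₂`, the original law gives `y₁ + y₂ ≤ Λ (u₁ + u₂)`, and the original right-hand
terms `u₁, u₂` are bounded by `KR v₁`, `KR λ⁻¹ v₂`, then `x₁ + x₂ ≤ K Λ (v₁ + v₂)` as soon as
`D KL · D KR ≤ K`, `λ, λ⁻¹ ≤ D`, `1 ≤ D`, `Λ ≥ 0`. [folklore] -/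
private theorem chain_bound {KL KR D K Λ : ℝ} (hKL : 0 ≤ KL) (hKR : 0 ≤ KR) (hD : 1 ≤ D)
    (hlam : 0 < lam) (hlamD : lam ≤ D) (hlamD' : lam⁻¹ ≤ D) (hΛ : 0 ≤ Λ)
    (hK : D * KL * (D * KR) ≤ K) {x₁ x₂ y₁ y₂ u₁ u₂ v₁ v₂ : ℝ≥0∞}
    (h₁ : x₁ ≤ ENNReal.ofReal KL * y₁) (h₂ : x₂ ≤ ENNReal.ofReal lam * (ENNReal.ofReal KL * y₂))
    (hlaw : y₁ + y₂ ≤ ENNReal.ofReal Λ * (u₁ + u₂)) (h₃ : u₁ ≤ ENNReal.ofReal KR * v₁)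
    (h₄ : u₂ ≤ ENNReal.ofReal KR * (ENNReal.ofReal lam⁻¹ * v₂)) :
    x₁ + x₂ ≤ ENNReal.ofReal (K * Λ) * (v₁ + v₂) := by
  have e₁ : x₁ ≤ ENNReal.ofReal (D * KL) * y₁ :=
    h₁.trans (mul_le_mul_left (ENNReal.ofReal_le_ofReal (le_mul_of_one_le_left hKL hD)) _)
  have e₂ : x₂ ≤ ENNReal.ofReal (D * KL) * y₂ := by
    refine h₂.trans ?_
    rw [← mul_assoc, ← ENNReal.ofReal_mul hlam.le]
    exact mul_le_mul_left (ENNReal.ofReal_le_ofReal (mul_le_mul_of_nonneg_right hlamD hKL)) _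
  have e₃ : u₁ ≤ ENNReal.ofReal (D * KR) * v₁ :=
    h₃.trans (mul_le_mul_left (ENNReal.ofReal_le_ofReal (le_mul_of_one_le_left hKR hD)) _)
  have e₄ : u₂ ≤ ENNReal.ofReal (D * KR) * v₂ := by
    refine h₄.trans ?_
    rw [← mul_assoc, ← ENNReal.ofReal_mul hKR, mul_comm D KR]
    exact mul_le_mul_left (ENNReal.ofReal_le_ofReal (mul_le_mul_of_nonneg_left hlamD' hKR)) _
  have hDL : 0 ≤ D * KL := mul_nonneg (zero_le_one.trans hD) hKL
  calc x₁ + x₂ ≤ ENNReal.ofReal (D * KL) * (y₁ + y₂) := by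
        rw [mul_add]
        exact add_le_add e₁ e₂
    _ ≤ ENNReal.ofReal (D * KL) *
          (ENNReal.ofReal Λ * (ENNReal.ofReal (D * KR) * (v₁ + v₂))) := by
        refine mul_le_mul_right (hlaw.trans (mul_le_mul_right ?_ _)) _
        rw [mul_add]
        exact add_le_add e₃ e₄
    _ = ENNReal.ofReal (D * KL * (D * KR) * Λ) * (v₁ + v₂) := by
        rw [show D * KL * (D * KR) * Λ = D * KL * (Λ * (D * KR)) by ring,
          ENNReal.ofReal_mul hDL, ENNReal.ofReal_mul hΛ]
        ring
    _ ≤ ENNReal.ofReal (K * Λ) * (v₁ + v₂) :=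
        mul_le_mul_left (ENNReal.ofReal_le_ofReal (mul_le_mul_of_nonneg_right hK hΛ)) _

/-- **Transport of the law along the dilation, abstract form.** With `x`, `v` the local
first-order energy of `α` and the weighted `k`-th order energy of `F` on the dilated chart as
functions of the leaf, `y`, `u` the same for the pulled-back pair `(α ∘ D_λ, F ∘ D_λ)` on the
original chart, and `x₀`, `y₀` the weighted bottom-leaf energies: the pointwise comparisons
`x(λτ) ≤ KL y(τ)`, `y₀ ≤ KR x₀`, `u(σ) ≤ KR v(λσ)` and the original law on `[τ₀/λ, τ₁/λ]` give
the dilated law on `[τ₀, τ₁]` with constant `K Λ` (the substitution `τ = λσ` in both time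
integrals, then `chain_bound`). [folklore] -/
private theorem law_transport {KL KR D K Λ τ₀ τ₁ : ℝ} (hlam : 0 < lam) (hKL : 0 ≤ KL)
    (hKR : 0 ≤ KR) (hD : 1 ≤ D) (hlamD : lam ≤ D) (hlamD' : lam⁻¹ ≤ D) (hΛ : 0 ≤ Λ)
    (hK : D * KL * (D * KR) ≤ K) (x y u v : ℝ → ℝ≥0∞) {x₀ y₀ : ℝ≥0∞}
    (hloc : ∀ τ, x (lam * τ) ≤ ENNReal.ofReal KL * y τ)
    (hlaw : y (τ₁ / lam) + ∫⁻ τ in Ioo (τ₀ / lam) (τ₁ / lam), y τ ≤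
      ENNReal.ofReal Λ * (y₀ + ∫⁻ σ in Ioo (τ₀ / lam) (τ₁ / lam), u σ))
    (h₀ : y₀ ≤ ENNReal.ofReal KR * x₀) (hsrc : ∀ σ, u σ ≤ ENNReal.ofReal KR * v (lam * σ)) :
    x τ₁ + ∫⁻ τ in Ioo τ₀ τ₁, x τ ≤ ENNReal.ofReal (K * Λ) * (x₀ + ∫⁻ τ in Ioo τ₀ τ₁, v τ) := by
  have h₁ : x τ₁ ≤ ENNReal.ofReal KL * y (τ₁ / lam) := by
    have h := hloc (τ₁ / lam)
    rwa [mul_div_cancel₀ _ hlam.ne'] at h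
  have h₂ : ∫⁻ τ in Ioo τ₀ τ₁, x τ ≤
      ENNReal.ofReal lam * (ENNReal.ofReal KL * ∫⁻ τ in Ioo (τ₀ / lam) (τ₁ / lam), y τ) := by
    rw [lintegral_Ioo_eq_mul_dilate hlam τ₀ τ₁ x]
    refine mul_le_mul_right ?_ _
    rw [← lintegral_const_mul' _ _ ENNReal.ofReal_ne_top]
    exact lintegral_mono fun σ ↦ hloc σ
  have h₄ : ∫⁻ σ in Ioo (τ₀ / lam) (τ₁ / lam), u σ ≤
      ENNReal.ofReal KR * (ENNReal.ofReal lam⁻¹ * ∫⁻ τ in Ioo τ₀ τ₁, v τ) := by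
    rw [← lintegral_Ioo_div_comp_mul hlam τ₀ τ₁ v,
      ← lintegral_const_mul' _ _ ENNReal.ofReal_ne_top]
    exact lintegral_mono fun σ ↦ hsrc σ
  exact chain_bound hKL hKR hD hlam hlamD hlamD' hΛ hK h₁ h₂ hlaw h₀ h₄

/-! ### The stub -/

/-- **`D4` — the black-box slab law is dilation covariant** (stub `stub_slabLaw_dilate` of the
line `bounded-kappa-closing-box` for the crux `BulkKerrCaptureC2`). Given the pull-back of sourced
slab pairs along the Kerr–Schild dilation `D_λ` (`D2`, hypothesis 1) and the two-sided comparison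
of the weighted Teukolsky energies under `D_λ`, uniform for `λ ∈ [lo, hi] ⊂ (0, ∞)` (`D3`,
hypothesis 2): for every `k`, `w` and every such range there is ONE `K ≥ 1` with
`TeukolskySlabLawOn M a r₀ k w R Λ → TeukolskySlabLawOn (λM) (λa) (λr₀) k w (λR) (K Λ)` for all
`λ ∈ [lo, hi]`, all `(M, a, r₀, R)` and all `Λ ≥ 0` — the law of
Dafermos–Holzegel–Rodnianski–Taylor, (1.3), at one mass yields the law at every mass in a compact
range by the homothety `g_{λM,λa}(λx) = g_{M,a}(x)` of the Kerr family (apply the law to the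
pulled-back pair on the slab `[τ₀/λ, τ₁/λ]`, compare the four energies, and substitute `τ = λσ`
in the two time integrals). [cite: DafermosHolzegelRodnianskiTaylor2022, §1.1 (1.3)] -/
theorem stub_slabLaw_dilate :
    (∀ [Kerr.Facts] (lam : ℝ) (hlam : 0 < lam) (M a r₀ : ℝ)
      [(Kerr.metric M a r₀).HasLeviCivita]
      [(Kerr.metric (lam * M) (lam * a) (lam * r₀)).HasLeviCivita]
      (s : ℤ) (τ₀ τ₁ : ℝ) (α F : Kerr.region (lam * a) (lam * r₀) → ℂ),
      Kerr.IsTeukolskyPairOnSlab (lam * M) (lam * a) (lam * r₀) s τ₀ τ₁ α F →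
      Kerr.IsTeukolskyPairOnSlab M a r₀ s (τ₀ / lam) (τ₁ / lam)
        (fun y : Kerr.region a r₀ ↦ α ⟨lam • (y : E4), (Kerr.mem_region_dilate_iff hlam).2 y.2⟩)
        (fun y : Kerr.region a r₀ ↦ F ⟨lam • (y : E4), (Kerr.mem_region_dilate_iff hlam).2 y.2⟩)) →
    (∀ (s : ℤ) (k : ℕ) (p lo hi : ℝ) (hlo : 0 < lo), lo ≤ hi → ∃ K : ℝ, 0 < K ∧
      ∀ (lam : ℝ) (hlam : lo ≤ lam), lam ≤ hi →
        ∀ (M a r₀ : ℝ) (α : Kerr.region (lam * a) (lam * r₀) → ℂ) (τ : ℝ) (A : Set E3),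
          Kerr.teukolskyEnergyOn (lam * M) (lam * a) (lam * r₀) s α (lam * τ) k p (lam • A) ≤
              ENNReal.ofReal K * Kerr.teukolskyEnergyOn M a r₀ s
                (fun y : Kerr.region a r₀ ↦
                  α ⟨lam • (y : E4), (Kerr.mem_region_dilate_iff (hlo.trans_le hlam)).2 y.2⟩)
                τ k p A ∧
            Kerr.teukolskyEnergyOn M a r₀ s
                (fun y : Kerr.region a r₀ ↦
                  α ⟨lam • (y : E4), (Kerr.mem_region_dilate_iff (hlo.trans_le hlam)).2 y.2⟩)
                τ k p A ≤
              ENNReal.ofReal K *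
                Kerr.teukolskyEnergyOn (lam * M) (lam * a) (lam * r₀) s α (lam * τ) k p (lam • A)) →
    ∀ [Kerr.Facts] (k : ℕ) (w lo hi : ℝ), 0 < lo → lo ≤ hi → ∃ K : ℝ, 1 ≤ K ∧
      ∀ lam : ℝ, lo ≤ lam → lam ≤ hi → ∀ (M a r₀ R Λ : ℝ), 0 ≤ Λ →
        Kerr.TeukolskySlabLawOn M a r₀ k w R Λ →
        Kerr.TeukolskySlabLawOn (lam * M) (lam * a) (lam * r₀) k w (lam * R) (K * Λ) := by
  intro hPair hEnergy _ k w lo hi hlo hlohi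
  -- the energy-comparison constants of `D3`, their maxima over `s = ±2`, and `D ≥ 1, λ, λ⁻¹`
  choose C hC₀ hC using hEnergy
  obtain ⟨D, hD, hhiD, hloD⟩ : ∃ D : ℝ, 1 ≤ D ∧ hi ≤ D ∧ lo⁻¹ ≤ D :=
    ⟨max 1 (max hi lo⁻¹), le_max_left _ _, (le_max_left _ _).trans (le_max_right _ _),
      (le_max_right _ _).trans (le_max_right _ _)⟩
  obtain ⟨KL, hKL₁, hKL₂, hKL0⟩ : ∃ KL : ℝ, C 2 1 0 lo hi hlo hlohi ≤ KL ∧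
      C (-2) 1 0 lo hi hlo hlohi ≤ KL ∧ 0 ≤ KL :=
    ⟨max (C 2 1 0 lo hi hlo hlohi) (C (-2) 1 0 lo hi hlo hlohi), le_max_left _ _,
      le_max_right _ _, (hC₀ 2 1 0 lo hi hlo hlohi).le.trans (le_max_left _ _)⟩
  obtain ⟨KR, hKR₁, hKR₂, hKR0⟩ : ∃ KR : ℝ, C 2 k w lo hi hlo hlohi ≤ KR ∧
      C (-2) k w lo hi hlo hlohi ≤ KR ∧ 0 ≤ KR :=
    ⟨max (C 2 k w lo hi hlo hlohi) (C (-2) k w lo hi hlo hlohi), le_max_left _ _,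
      le_max_right _ _, (hC₀ 2 k w lo hi hlo hlohi).le.trans (le_max_left _ _)⟩
  refine ⟨max 1 (D * KL * (D * KR)), le_max_left _ _, ?_⟩
  intro lam hlam hlamhi M a r₀ R Λ hΛ hlaw inst s hs τ₀ τ₁ hτ α F hpair
  have hlam0 : 0 < lam := hlo.trans_le hlam
  have hne : lam ≠ 0 := hlam0.ne'
  have hsL : C s 1 0 lo hi hlo hlohi ≤ KL := by
    rcases hs with rfl | rfl
    exacts [hKL₁, hKL₂]
  have hsR : C s k w lo hi hlo hlohi ≤ KR := by
    rcases hs with rfl | rfl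
    exacts [hKR₁, hKR₂]
  haveI : (Kerr.metric M a r₀).HasLeviCivita := PseudoRiemannianMetric.hasLeviCivita _
  -- the pulled-back pair `(β, G) = (α ∘ D_λ, F ∘ D_λ)` on the slab `[τ₀/λ, τ₁/λ]`, the law there
  set β : Kerr.region a r₀ → ℂ := fun y ↦
    α ⟨lam • (y : E4), (Kerr.mem_region_dilate_iff hlam0).2 y.2⟩
  set G : Kerr.region a r₀ → ℂ := fun y ↦
    F ⟨lam • (y : E4), (Kerr.mem_region_dilate_iff hlam0).2 y.2⟩
  have H := hlaw s hs (τ₀ / lam) (τ₁ / lam) (div_le_div_of_nonneg_right hτ hlam0.le) β G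
    (hPair lam hlam0 M a r₀ s τ₀ τ₁ α F hpair)
  -- the four energies as functions of the leaf
  set x : ℝ → ℝ≥0∞ := fun τ ↦ Kerr.teukolskyEnergyOn (lam * M) (lam * a) (lam * r₀) s α τ 1 0
    (Metric.closedBall (0 : E3) (lam * R))
  set y : ℝ → ℝ≥0∞ := fun τ ↦
    Kerr.teukolskyEnergyOn M a r₀ s β τ 1 0 (Metric.closedBall (0 : E3) R)
  set u : ℝ → ℝ≥0∞ := fun σ ↦ Kerr.teukolskyEnergyOn M a r₀ s G σ k w univ
  set v : ℝ → ℝ≥0∞ := fun τ ↦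
    Kerr.teukolskyEnergyOn (lam * M) (lam * a) (lam * r₀) s F τ k w univ
  -- the three comparisons supplied by `D3` (`λ • B̄(0,R) = B̄(0,λR)`, `λ • ℝ³ = ℝ³`)
  have hloc : ∀ τ, x (lam * τ) ≤ ENNReal.ofReal KL * y τ := fun τ ↦ by
    have h := (hC s 1 0 lo hi hlo hlohi lam hlam hlamhi M a r₀ α τ
      (Metric.closedBall (0 : E3) R)).1
    rw [smul_closedBall_zero hlam0] at h
    exact h.trans (mul_le_mul_left (ENNReal.ofReal_le_ofReal hsL) _)
  have h₀ : Kerr.teukolskyEnergyOn M a r₀ s β (τ₀ / lam) k w univ ≤ ENNReal.ofReal KR *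
      Kerr.teukolskyEnergyOn (lam * M) (lam * a) (lam * r₀) s α τ₀ k w univ := by
    have h := (hC s k w lo hi hlo hlohi lam hlam hlamhi M a r₀ α (τ₀ / lam) univ).2
    rw [Set.smul_set_univ₀ hne, mul_div_cancel₀ _ hne] at h
    exact h.trans (mul_le_mul_left (ENNReal.ofReal_le_ofReal hsR) _)
  have hsrc : ∀ σ, u σ ≤ ENNReal.ofReal KR * v (lam * σ) := fun σ ↦ by
    have h := (hC s k w lo hi hlo hlohi lam hlam hlamhi M a r₀ F σ univ).2
    rw [Set.smul_set_univ₀ hne] at h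
    exact h.trans (mul_le_mul_left (ENNReal.ofReal_le_ofReal hsR) _)
  exact law_transport hlam0 hKL0 hKR0 hD (hlamhi.trans hhiD) ((inv_anti₀ hlo hlam).trans hloD) hΛ
    (le_max_right _ _) x y u v hloc H h₀ hsrc

end Summit.FinalStateConjecture.FinalStateConjecture.Theorems.BulkKerrCaptureC2.SlabLawDilate

end
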